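import Mathlib
import Literature.MathematicalPhysics.QuantumFieldTheory.Luscher2010.TrivializingMaps
import Literature.MathematicalPhysics.QuantumFieldTheory.Luscher2010.FlowActionSeriesProofs
import Literature.MathematicalPhysics.QuantumFieldTheory.Luscher2010.EulerStepProofs
import Summits.Ventures.LatticeQCDFlow.TrivializingMaps.TruncationDefect
import Summits.Ventures.LatticeQCDFlow.TrivializingMaps.DefectLogWeight
import Summits.Ventures.LatticeQCDFlow.TrivializingMaps.GaugeCovariance

/-!
# LatticeQCDFlow / TrivializingMaps — integration by parts for the link derivatives against the
# product Haar measure `D[U]` on `SU(n)^E`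

HONEST FRAMING: exact (Metropolis-corrected) sampling algorithms for lattice gauge theory; figures
of merit are autocorrelation/cost numbers at stated couplings and volumes; no continuum-physics claim.

Venture `LatticeQCDFlow` (cell pub-lqcd), topic `TrivializingMaps`, row 31 (lean-2). The measure-side
input of the Jacobian formula (Lüscher 2010 eq. (3.9)) proved in `JacobianFormula.lean`:

* `integral_linkDeriv_coeConfig_eq_zero` — **`∫ D[U] ∂_{e,X} F(U) = 0`** for `X ∈ 𝔰𝔲(n)` and `F`
  an ambient `C¹` function: left invariance of `D[U] = ∏ dU(e)` under `U(e) ↦ e^{sX} U(e)`,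
  differentiated at `s = 0` under the integral sign (the "partial integration" behind the symmetry
  (4.7)–(4.8) of Lüscher's operator);
* `linkDeriv_mul` — the product rule for `∂_{e,X}`;
* `fderiv_apply_vf_eq_sum_linkDeriv` — `Dψ(U)[Z(U) U] = ∑_{e,a} Zᵃ(U)(e) ∂ᵃ_e ψ(U)` for a tangent
  link field `Z`;
* `integral_fderiv_add_linkDiv_mul_eq_zero` — the **Liouville identity with source**:
  `∫ D[U] ( Dψ(U)[Z(U) U] + (div Z)(U) ψ(U) ) = 0`, i.e. `∫ ∑_{e,a} ∂ᵃ_e (Zᵃ ψ) = 0`.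

All elementary ([folklore]); Mathlib's `integral_mul_left_eq_self` for the product Haar measure and
`hasDerivAt_integral_of_dominated_loc_of_deriv_le`.
-/

noncomputable section

open MeasureTheory Matrix Set Filter Function Metric
open scoped Matrix Topology NNReal

namespace Summit.Ventures.LatticeQCDFlow.TrivializingMaps

open Literature.MathematicalPhysics.QuantumFieldTheory
open Literature.MathematicalPhysics.QuantumFieldTheory.Luscher2010
open Literature.MathematicalPhysics.QuantumFieldTheory.WilsonFlow
open scoped Matrix.Norms.Frobenius ContDiff

variable {d L n : ℕ}

/-! ## §1. Algebra: the product rule, tangent fields in coordinates -/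

section Algebra

variable [NeZero L]

/-- **Product rule** for the link derivative, for functions differentiable at the point. [folklore] -/
theorem linkDeriv_mul (e : Edge d L) (X : Matrix (Fin n) (Fin n) ℂ) {f g : AmbConfig d L n → ℝ}
    {W : AmbConfig d L n} (hf : DifferentiableAt ℝ f W) (hg : DifferentiableAt ℝ g W) :
    linkDeriv e X (fun W' => f W' * g W') W = f W * linkDeriv e X g W + g W * linkDeriv e X f W := by
  have hcf := hasDerivAt_comp_linkCurve hf e X
  have hcg := hasDerivAt_comp_linkCurve hg e X
  have h : HasDerivAt (fun s : ℝ => (fun W' => f W' * g W')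
      (Function.update W e (NormedSpace.exp ((s : ℂ) • X) * W e)))
      (fderiv ℝ f W (Pi.single e (X * W e)) *
          g (Function.update W e (NormedSpace.exp (((0 : ℝ) : ℂ) • X) * W e)) +
        f (Function.update W e (NormedSpace.exp (((0 : ℝ) : ℂ) • X) * W e)) *
          fderiv ℝ g W (Pi.single e (X * W e))) 0 := hcf.mul hcg
  rw [linkCurve_zero] at h
  unfold linkDeriv
  rw [h.deriv, hcf.deriv, hcg.deriv]
  ring

/-- A tangent link field `Z` acts on `U ∈ SU(n)^E` by the tangent vector `(Z(U)(e) U(e))_e`, which is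
`∑_{e,a} Zᵃ(U)(e) · δ_e Tᵃ U(e)`; hence **`Dψ(U)[Z(U) U] = ∑_{e,a} Zᵃ(U)(e) ∂ᵃ_e ψ(U)`** (eq. (A.3)
summed over links and colours). [cite: Luscher2010Trivializing, App. A eqs. (A.3), (A.10)] -/
theorem fderiv_apply_vf_eq_sum_linkDeriv (B : SuBasis n) {ψ : AmbConfig d L n → ℝ}
    {W : AmbConfig d L n} (hψ : DifferentiableAt ℝ ψ W) {Y : AmbConfig d L n}
    (hY : ∀ e, Y e ∈ suAlgebra n) :
    fderiv ℝ ψ W (fun e => Y e * W e) = ∑ e, ∑ a, B.coord a (Y e) * linkDeriv e (B.T a) ψ W := by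
  have hv : (fun e => Y e * W e) =
      fun e => (∑ a, ((B.coord a (Y e) : ℝ) : ℂ) • B.T a) * W e := by
    funext e
    rw [sum_coord_smul_eq B (hY e)]
  rw [hv]
  exact fderiv_apply_sum_smul_mul B hψ (fun e a => B.coord a (Y e))

/-- The coordinate functional `M ↦ -2 Re tr(Tᵃ M)` is smooth (it is real-linear). [folklore] -/
theorem suBasis_contDiff_coord (B : SuBasis n) (a : B.ι) {m : WithTop ℕ∞} :
    ContDiff ℝ m (fun M : Matrix (Fin n) (Fin n) ℂ => B.coord a M) := by
  unfold SuBasis.coord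
  refine contDiff_const.mul ?_
  exact Complex.reCLM.contDiff.comp (contDiff_trace.comp (contDiff_const.mul contDiff_id))

end Algebra

/-! ## §2. Integration by parts against the product Haar measure -/

section IBP

variable [NeZero L]

omit [NeZero L] in
/-- Left multiplication of the link `e` by a group element, read in the ambient space, is an update of
that link. [folklore] -/
theorem coeConfig_mulSingle_mul (V : GaugeConfig d L (Matrix.specialUnitaryGroup (Fin n) ℂ))
    (e : Edge d L) (g : Matrix.specialUnitaryGroup (Fin n) ℂ) :
    coeConfig (Pi.mulSingle e g * V) =
      Function.update (coeConfig V) e ((g : Matrix (Fin n) (Fin n) ℂ) * coeConfig V e) := by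
  funext e'
  rcases eq_or_ne e' e with rfl | hne
  · simp [coeConfig_apply, Function.update_self]
  · simp [coeConfig_apply, Pi.mulSingle, hne]

omit [NeZero L] in
/-- The link curve `s ↦ (e^{sX} W(e) at e, W elsewhere)` has velocity `δ_e · X e^{sX} W(e)` at every `s`.
[folklore] -/
theorem hasDerivAt_linkCurve_at (W : AmbConfig d L n) (e : Edge d L) (X : Matrix (Fin n) (Fin n) ℂ)
    (s : ℝ) :
    HasDerivAt (fun s : ℝ => Function.update W e (NormedSpace.exp ((s : ℂ) • X) * W e))
      (Pi.single e (X * (NormedSpace.exp ((s : ℂ) • X) * W e))) s := by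
  refine hasDerivAt_pi.2 fun e' => ?_
  rcases eq_or_ne e' e with rfl | hne
  · simp only [Function.update_self, Pi.single_eq_same]
    have h := (hasDerivAt_exp_smul_const' (𝕂 := ℝ) X s).mul_const (W e')
    have hfun : (fun s : ℝ => NormedSpace.exp ((s : ℂ) • X) * W e') =
        fun s : ℝ => NormedSpace.exp (s • X) * W e' := by
      funext s; rw [Complex.coe_smul]
    rw [hfun, Complex.coe_smul, ← mul_assoc]
    exact h
  · simp only [Function.update_of_ne hne, Pi.single_eq_of_ne hne]
    exact hasDerivAt_const _ _

omit [NeZero L] in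
/-- The link curves depend continuously on `(s, U)`. [folklore] -/
theorem continuous_linkCurve_coeConfig (e : Edge d L) (X : Matrix (Fin n) (Fin n) ℂ) :
    Continuous fun p : ℝ × GaugeConfig d L (Matrix.specialUnitaryGroup (Fin n) ℂ) =>
      Function.update (coeConfig p.2) e (NormedSpace.exp ((p.1 : ℂ) • X) * coeConfig p.2 e) := by
  have hexp : Continuous fun s : ℝ => NormedSpace.exp ((s : ℂ) • X) :=
    NormedSpace.exp_continuous.comp (Complex.continuous_ofReal.smul continuous_const)
  refine continuous_pi fun e' => ?_
  rcases eq_or_ne e' e with rfl | hne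
  · simp only [Function.update_self]
    exact (hexp.comp continuous_fst).mul
      ((continuous_apply e').comp (continuous_coeConfig.comp continuous_snd))
  · simp only [Function.update_of_ne hne]
    exact (continuous_apply e').comp (continuous_coeConfig.comp continuous_snd)

/-- **Left invariance of `D[U]` along a link curve**: `∫ D[U] F(e^{sX} U(e), …) = ∫ D[U] F(U)` for
`X ∈ 𝔰𝔲(n)`. [folklore] -/
theorem integral_comp_linkCurve_eq {F : AmbConfig d L n → ℝ} (e : Edge d L)
    {X : Matrix (Fin n) (Fin n) ℂ} (hX : X ∈ suAlgebra n) (s : ℝ) :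
    ∫ V, F (Function.update (coeConfig V) e (NormedSpace.exp ((s : ℂ) • X) * coeConfig V e))
        ∂(trivialMeasure (Matrix.specialUnitaryGroup (Fin n) ℂ) d L) =
      ∫ V, F (coeConfig V) ∂(trivialMeasure (Matrix.specialUnitaryGroup (Fin n) ℂ) d L) := by
  haveI : (trivialMeasure (Matrix.specialUnitaryGroup (Fin n) ℂ) d L).IsMulLeftInvariant := by
    unfold trivialMeasure; infer_instance
  set g : GaugeConfig d L (Matrix.specialUnitaryGroup (Fin n) ℂ) :=
    Pi.mulSingle e ⟨NormedSpace.exp ((s : ℂ) • X), exp_smul_mem_specialUnitaryGroup hX s⟩ with hg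
  have h := integral_mul_left_eq_self
    (μ := trivialMeasure (Matrix.specialUnitaryGroup (Fin n) ℂ) d L) (fun V => F (coeConfig V)) g
  simp only [hg, coeConfig_mulSingle_mul] at h
  exact h

/-- **Integration by parts on `SU(n)^E`**: `∫ D[U] ∂_{e,X} F(U) = 0` for `X ∈ 𝔰𝔲(n)` and an ambient
`C¹` function `F` (left invariance of the product Haar measure under `U(e) ↦ e^{sX} U(e)`,
differentiated at `s = 0` under the integral sign). [cite: Luscher2010Trivializing, §4.2 eqs. (4.7)–(4.8)] -/
theorem integral_linkDeriv_coeConfig_eq_zero {F : AmbConfig d L n → ℝ} (hF : ContDiff ℝ 1 F)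
    (e : Edge d L) {X : Matrix (Fin n) (Fin n) ℂ} (hX : X ∈ suAlgebra n) :
    ∫ V, linkDeriv e X F (coeConfig V)
      ∂(trivialMeasure (Matrix.specialUnitaryGroup (Fin n) ℂ) d L) = 0 := by
  haveI : SecondCountableTopology (Matrix (Fin n) (Fin n) ℂ) :=
    inferInstanceAs (SecondCountableTopology (Fin n → Fin n → ℂ))
  haveI : SecondCountableTopology (Matrix.specialUnitaryGroup (Fin n) ℂ) :=
    Topology.IsEmbedding.subtypeVal.secondCountableTopology
  haveI : IsProbabilityMeasure (trivialMeasure (Matrix.specialUnitaryGroup (Fin n) ℂ) d L) := by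
    unfold trivialMeasure; infer_instance
  -- the link curve through `U` and the integrand `F` along it, with its `s`-derivative
  let c : ℝ → GaugeConfig d L (Matrix.specialUnitaryGroup (Fin n) ℂ) → AmbConfig d L n :=
    fun s V => Function.update (coeConfig V) e (NormedSpace.exp ((s : ℂ) • X) * coeConfig V e)
  let Φs : ℝ → GaugeConfig d L (Matrix.specialUnitaryGroup (Fin n) ℂ) → ℝ := fun s V => F (c s V)
  let Φs' : ℝ → GaugeConfig d L (Matrix.specialUnitaryGroup (Fin n) ℂ) → ℝ := fun s V =>
    fderiv ℝ F (c s V) (Pi.single e (X * (NormedSpace.exp ((s : ℂ) • X) * coeConfig V e)))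
  have hderiv : ∀ V s, HasDerivAt (fun s => Φs s V) (Φs' s V) s := fun V s =>
    (hF.differentiable one_ne_zero (c s V)).hasFDerivAt.comp_hasDerivAt s
      (hasDerivAt_linkCurve_at (coeConfig V) e X s)
  -- invariance: the integral does not depend on `s`
  have hconst : ∀ s, ∫ V, Φs s V ∂(trivialMeasure (Matrix.specialUnitaryGroup (Fin n) ℂ) d L) =
      ∫ V, F (coeConfig V) ∂(trivialMeasure (Matrix.specialUnitaryGroup (Fin n) ℂ) d L) :=
    fun s => integral_comp_linkCurve_eq e hX s
  -- continuity of the curve, of the integrand and of its derivative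
  have hcc : Continuous fun p : ℝ × GaugeConfig d L (Matrix.specialUnitaryGroup (Fin n) ℂ) => c p.1 p.2 :=
    continuous_linkCurve_coeConfig e X
  have hΦsu_cont : Continuous fun p : ℝ × GaugeConfig d L (Matrix.specialUnitaryGroup (Fin n) ℂ) =>
      Φs p.1 p.2 := hF.continuous.comp hcc
  have hΦs_cont : ∀ s, Continuous (Φs s) := fun s => hΦsu_cont.uncurry_left s
  have hΦs'_cont : Continuous fun p : ℝ × GaugeConfig d L (Matrix.specialUnitaryGroup (Fin n) ℂ) =>
      Φs' p.1 p.2 := by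
    have h1 : Continuous fun p : ℝ × GaugeConfig d L (Matrix.specialUnitaryGroup (Fin n) ℂ) =>
        fderiv ℝ F (c p.1 p.2) := (hF.continuous_fderiv one_ne_zero).comp hcc
    have h2 : Continuous fun p : ℝ × GaugeConfig d L (Matrix.specialUnitaryGroup (Fin n) ℂ) =>
        (Pi.single e (X * c p.1 p.2 e) : AmbConfig d L n) :=
      (contDiff_pi_single_mul_apply (d := d) (L := L) (n := n) e X).continuous.comp hcc
    have h3 : (fun p : ℝ × GaugeConfig d L (Matrix.specialUnitaryGroup (Fin n) ℂ) =>
        (Pi.single e (X * (NormedSpace.exp ((p.1 : ℂ) • X) * coeConfig p.2 e)) : AmbConfig d L n)) =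
        fun p => (Pi.single e (X * c p.1 p.2 e) : AmbConfig d L n) := by
      funext p
      simp only [c, Function.update_self]
    have h2' := h3 ▸ h2
    exact h1.clm_apply h2'
  have hΦs't_cont : ∀ s, Continuous (Φs' s) := fun s => hΦs'_cont.uncurry_left s
  -- a uniform bound for the derivative on `[-1, 1] × SU(n)^E`
  obtain ⟨C, hC⟩ : ∃ C, ∀ p ∈ (closedBall (0 : ℝ) 1) ×ˢ
      (univ : Set (GaugeConfig d L (Matrix.specialUnitaryGroup (Fin n) ℂ))), ‖Φs' p.1 p.2‖ ≤ C :=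
    ((isCompact_closedBall (0 : ℝ) 1).prod isCompact_univ).exists_bound_of_continuousOn
      hΦs'_cont.continuousOn
  -- differentiate under the integral sign at `s = 0`
  have hmain := hasDerivAt_integral_of_dominated_loc_of_deriv_le
    (μ := trivialMeasure (Matrix.specialUnitaryGroup (Fin n) ℂ) d L) (F := Φs) (F' := Φs')
    (x₀ := (0 : ℝ)) (s := ball 0 1) (bound := fun _ => C) (ball_mem_nhds 0 one_pos)
    (Eventually.of_forall fun s => (hΦs_cont s).aestronglyMeasurable)
    ((BoundedContinuousFunction.mkOfCompact ⟨Φs 0, hΦs_cont 0⟩).integrable _)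
    (hΦs't_cont 0).aestronglyMeasurable
    (ae_of_all _ fun V s hs => hC (s, V) ⟨ball_subset_closedBall hs, mem_univ _⟩)
    (integrable_const C) (ae_of_all _ fun V s _ => hderiv V s)
  have hzero : HasDerivAt (fun s => ∫ V, Φs s V
      ∂(trivialMeasure (Matrix.specialUnitaryGroup (Fin n) ℂ) d L)) 0 0 := by
    have : (fun s => ∫ V, Φs s V ∂(trivialMeasure (Matrix.specialUnitaryGroup (Fin n) ℂ) d L)) =
        fun _ => ∫ V, F (coeConfig V) ∂(trivialMeasure (Matrix.specialUnitaryGroup (Fin n) ℂ) d L) :=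
      funext hconst
    rw [this]
    exact hasDerivAt_const _ _
  have heq := hmain.2.unique hzero
  -- at `s = 0` the derivative is the link derivative
  have h0 : ∀ V, Φs' 0 V = linkDeriv e X F (coeConfig V) := fun V => by
    simp only [Φs', c, Complex.ofReal_zero, zero_smul, NormedSpace.exp_zero, one_mul,
      Function.update_eq_self]
    exact (linkDeriv_eq_fderiv (hF.differentiable one_ne_zero _) e X).symm
  simp_rw [h0] at heq
  exact heq

/-- **The Liouville identity with source for `D[U]`**: for a tangent `C¹` link field `Y` (`Y(W)(e) ∈
𝔰𝔲(n)` on `SU(n)^E`) and an ambient `C¹` function `ψ`,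
`∫ D[U] ( Dψ(U)[Y(U) U] + (div Y)(U) ψ(U) ) = ∫ D[U] ∑_{e,a} ∂ᵃ_e(Yᵃ ψ)(U) = 0`.  This is the
infinitesimal form of the Jacobian formula (3.9) (and of the `(φ, 𝓛 ψ)` symmetry (4.7)–(4.8)).
[cite: Luscher2010Trivializing, §3.2 eq. (3.9), §4.2 eqs. (4.7)–(4.8)] -/
theorem integral_fderiv_add_linkDiv_mul_eq_zero (B : SuBasis n) {ψ : AmbConfig d L n → ℝ}
    (hψ : ContDiff ℝ 1 ψ) {Y : AmbConfig d L n → AmbConfig d L n} (hY : ContDiff ℝ 1 Y)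
    (hYt : ∀ (U : GaugeConfig d L (Matrix.specialUnitaryGroup (Fin n) ℂ)) e, Y (coeConfig U) e ∈ suAlgebra n) :
    ∫ V, (fderiv ℝ ψ (coeConfig V) (fun e => Y (coeConfig V) e * coeConfig V e)
        + linkDiv B Y (coeConfig V) * ψ (coeConfig V))
      ∂(trivialMeasure (Matrix.specialUnitaryGroup (Fin n) ℂ) d L) = 0 := by
  haveI : SecondCountableTopology (Matrix (Fin n) (Fin n) ℂ) :=
    inferInstanceAs (SecondCountableTopology (Fin n → Fin n → ℂ))
  haveI : SecondCountableTopology (Matrix.specialUnitaryGroup (Fin n) ℂ) :=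
    Topology.IsEmbedding.subtypeVal.secondCountableTopology
  haveI : IsProbabilityMeasure (trivialMeasure (Matrix.specialUnitaryGroup (Fin n) ℂ) d L) := by
    unfold trivialMeasure; infer_instance
  set μ := trivialMeasure (Matrix.specialUnitaryGroup (Fin n) ℂ) d L with hμ
  -- the coordinate functions `Yᵃ(·)(e)` are `C¹`
  set cY : Edge d L → B.ι → AmbConfig d L n → ℝ := fun e a W => B.coord a (Y W e) with hcY
  have hcY1 : ∀ e a, ContDiff ℝ 1 (cY e a) := fun e a =>
    (suBasis_contDiff_coord B a).comp ((contDiff_apply ℝ _ e).comp hY)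
  -- pointwise: the integrand is `∑_{e,a} ∂ᵃ_e (Yᵃ ψ)`
  have hpt : ∀ V : GaugeConfig d L (Matrix.specialUnitaryGroup (Fin n) ℂ),
      fderiv ℝ ψ (coeConfig V) (fun e => Y (coeConfig V) e * coeConfig V e)
        + linkDiv B Y (coeConfig V) * ψ (coeConfig V)
      = ∑ e, ∑ a, linkDeriv e (B.T a) (fun W' => cY e a W' * ψ W') (coeConfig V) := by
    intro V
    have hψd : DifferentiableAt ℝ ψ (coeConfig V) := hψ.differentiable one_ne_zero _
    rw [fderiv_apply_vf_eq_sum_linkDeriv B hψd (hYt V)]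
    unfold linkDiv
    rw [Finset.sum_mul, ← Finset.sum_add_distrib]
    refine Finset.sum_congr rfl fun e _ => ?_
    rw [Finset.sum_mul, ← Finset.sum_add_distrib]
    refine Finset.sum_congr rfl fun a _ => ?_
    rw [linkDeriv_mul e (B.T a) ((hcY1 e a).differentiable one_ne_zero _) hψd]
    ring
  simp_rw [hpt]
  have hint : ∀ e a, Integrable (fun V : GaugeConfig d L (Matrix.specialUnitaryGroup (Fin n) ℂ) =>
      linkDeriv e (B.T a) (fun W' => cY e a W' * ψ W') (coeConfig V)) μ := by
    intro e a
    have hprod : ContDiff ℝ 1 (fun W' => cY e a W' * ψ W') := (hcY1 e a).mul hψ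
    have hcont : Continuous fun V : GaugeConfig d L (Matrix.specialUnitaryGroup (Fin n) ℂ) =>
        linkDeriv e (B.T a) (fun W' => cY e a W' * ψ W') (coeConfig V) := by
      have heq : (fun V : GaugeConfig d L (Matrix.specialUnitaryGroup (Fin n) ℂ) =>
          linkDeriv e (B.T a) (fun W' => cY e a W' * ψ W') (coeConfig V)) =
          fun V => fderiv ℝ (fun W' => cY e a W' * ψ W') (coeConfig V)
            (Pi.single e (B.T a * coeConfig V e)) :=
        funext fun V => linkDeriv_eq_fderiv (hprod.differentiable one_ne_zero _) e (B.T a)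
      rw [heq]
      exact ((hprod.continuous_fderiv one_ne_zero).comp continuous_coeConfig).clm_apply
        ((contDiff_pi_single_mul_apply (d := d) (L := L) (n := n) e (B.T a)).continuous.comp
          continuous_coeConfig)
    exact (BoundedContinuousFunction.mkOfCompact ⟨_, hcont⟩).integrable _
  rw [integral_finsetSum _ fun e _ => integrable_finsetSum _ fun a _ => hint e a]
  refine Finset.sum_eq_zero fun e _ => ?_
  rw [integral_finsetSum _ fun a _ => hint e a]
  refine Finset.sum_eq_zero fun a _ => ?_
  exact integral_linkDeriv_coeConfig_eq_zero ((hcY1 e a).mul hψ) e (B.mem a)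

end IBP

end Summit.Ventures.LatticeQCDFlow.TrivializingMaps

end
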